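import Summits.NavierStokesRegularity.FluidComputer.BlockViscousRent
import HarnessLib

/-!
# Fluid computer — block energies are CONTINUOUS IN TIME along a maximal smooth solution; the rent in Markov form

HONEST FRAMING (cell `pub-fluidc`, verbatim): *low prior, high value-of-information experiment on Tao's
machine paradigm; NOT a claim that NS blows up.* Theorem side of the cell (support of the transfer face L12–L13 and of
the viscous rent L12⁗); nothing here is evidence of blow-up.

The transport files (`BlockEnergyTransport`, `BlockEnergyDissipation`) read the block energies `‖Δ̇_j u(τ)‖₂²` of a
maximal smooth finite-energy solution only at pairs of times. Statements "the level spends the time `ρ` at energy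
`≥ E`" need the block energy to be a measurable function of time. This file supplies it, again from Leray's regular
local solutions: on a regular slab the block energy is a primitive (`IsRegularSlab.integral_norm_blockFn_sq_sub_eq`:
`∫‖Δ̇_j v(t)‖² − ∫‖Δ̇_j v(s)‖² = 2∫ₛᵗ ∫⟪Δ̇_j v, Δ̇_j ∂ₜv⟫` with an interval-integrable integrand), hence continuous, and
the maximal solution coincides pointwise with such a `v` near every interior time.

* `continuousAt_blockL2_sq`, `continuousOn_blockL2_sq` — for a maximal smooth solution `(u, p)` on `ℝ³ × [0, T)`
  (`ν > 0`), Leray–Hopf from `u 0`, and every level `j`, `τ ↦ ‖Δ̇_j u(τ)‖₂²` is continuous on `(0, T)` (as an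
  `ℝ≥0∞`-valued function); `aemeasurable_blockL2_sq_Ioc` — hence a.e.-measurable on every `(s, t] ⊂ (0, T)`.
* `feeding_ge_level_rent` (**the VISCOUS RENT, Markov form**) — with the reverse-Bernstein constant `C_r` of
  `BlockViscousRent.feeding_ge_rent`: for all `0 < s ≤ t < T`, every level `j` and every threshold `E ∈ [0, ∞]`,
  `2ν · 4^j · E · |{τ ∈ (s,t] : ‖Δ̇_j u(τ)‖₂² ≥ E}| ≤ 3 C_r² ‖Δ̇_j u(s)‖₂² + 6 C_r² ∫⁻_{(s,t]} (−N_j(u(τ)))⁺ dτ` — HOLDING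
  level `j` at energy at least `E` during a total time `ρ` inside `(s, t]` requires the initial stock plus the nonlinear
  feeding to cover the rent `ν k_j² E ρ` (`k_j = 2^j`) up to the absolute factor `3 C_r²`. In the cell's words: the
  dwell time of a level at a given energy is priced at the viscous rate of that level; the occupation / residence
  floors (`LevelOccupationFloor`, `OccupationFloorsHold`: the front dwells at saturated levels for at least `c` turn-over
  times, infinitely often) therefore come with a feeding bill, payable — by L12′ — only through the two local channels.

0 sorry; no new definitions, no named facts (inputs: `leray_local_regular_H1_holds`, `serrin_weak_strong_uniqueness_holds`,
`isSmoothSlabSolution_of_regular`, `IsRegularSlab.integral_norm_blockFn_sq_sub_eq`,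
`IsRegularSlab.intervalIntegrable_inner_blockFn`, `IsMaximalSmoothSolution.isH1RegularOn_Ioo`,
`BlockViscousRent.feeding_ge_rent`).

## References

* A. Cheskidov, R. Shvydkoy, Arch. Ration. Mech. Anal. 195 (2010) 159–169 = arXiv:0708.3067, Lemma 3.2 (proof, (8)).
  [CheskidovShvydkoy2010]
* J. C. Robinson, J. L. Rodrigo, W. Sadowski, *The Three-Dimensional Navier–Stokes Equations*, CUP 2016, Thm. 6.10,
  Thm. 6.15. [RobinsonRodrigoSadowski2016]
-/

noncomputable section

open MeasureTheory Set Function Filter Topology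
open scoped ENNReal NNReal RealInnerProductSpace
open Literature.Analysis.FluidPDE Literature.Analysis.FunctionSpaces
open Summit.NavierStokesRegularity.FluidComputer.BlockEnergyTransport

namespace Summit.NavierStokesRegularity.FluidComputer.BlockEnergyContinuity

/-! ## Continuity in time of the block energies -/

/-- **Block energies are continuous in time along a maximal smooth finite-energy solution.** For a maximal smooth
solution `(u, p)` of the unforced Navier–Stokes system on `ℝ³ × [0, T)` (`ν > 0`) which is Leray–Hopf from `u 0`, every
level `j` and every `τ₀ ∈ (0, T)`: `τ ↦ ‖Δ̇_j u(τ)‖₂²` is continuous at `τ₀`. Proof: near `τ₀`, `u` coincides pointwise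
with Leray's regular local solution `v` from a good time `σ < τ₀` (weak–strong uniqueness + continuity of the slices);
on a regular slab around `τ₀ − σ` the block energy of `v` is a primitive of an interval-integrable function
(`IsRegularSlab.integral_norm_blockFn_sq_sub_eq`, `IsRegularSlab.intervalIntegrable_inner_blockFn`), hence continuous.
[cite: CheskidovShvydkoy2010, Lemma 3.2 (proof, (8))] -/
theorem continuousAt_blockL2_sq {ν T : ℝ} (hν : 0 < ν) (hT : 0 < T)
    {u : ℝ → EuclideanSpace ℝ (Fin 3) → EuclideanSpace ℝ (Fin 3)} {p : ℝ → EuclideanSpace ℝ (Fin 3) → ℝ}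
    (hmax : IsMaximalSmoothSolution ν 0 u p T) (hLH : IsLerayHopfOn T ν 0 (u 0) u) (j : ℤ)
    {τ₀ : ℝ} (hτ₀ : τ₀ ∈ Ioo 0 T) :
    ContinuousAt (fun τ => blockL2 (u τ) j ^ 2) τ₀ := by
  obtain ⟨c₀, hc₀, hreg⟩ := leray_local_regular_H1_holds
  have hH1 : IsH1RegularOn (Ioo 0 T) u := hmax.isH1RegularOn_Ioo hν hT hLH
  obtain ⟨M, hM, hMK⟩ := hH1.exists_forall_le (isCompact_Icc : IsCompact (Icc (τ₀ / 2) τ₀))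
    fun t ht => ⟨by linarith [ht.1, hτ₀.1], ht.2.trans_lt hτ₀.2⟩
  set A : ℝ := M.toReal with hA
  set δ : ℝ := min (c₀ * ν ^ 3 / (A ^ 2 + 1)) (τ₀ / 2) with hδ
  have hδpos : 0 < δ := lt_min (div_pos (by positivity) (by positivity)) (by linarith [hτ₀.1])
  have hδτ : δ ≤ τ₀ / 2 := min_le_right _ _
  have hAδ : A ^ 2 * δ ≤ c₀ * ν ^ 3 := by
    calc A ^ 2 * δ ≤ A ^ 2 * (c₀ * ν ^ 3 / (A ^ 2 + 1)) := by gcongr; exact min_le_left _ _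
      _ = c₀ * ν ^ 3 * (A ^ 2 / (A ^ 2 + 1)) := by ring
      _ ≤ c₀ * ν ^ 3 * 1 := by gcongr; rw [div_le_one (by positivity)]; linarith
      _ = c₀ * ν ^ 3 := mul_one _
  -- a good time just before `τ₀`, and Leray's regular solution from it
  obtain ⟨σ, hσ, hLHσ⟩ := hLH.exists_isLerayHopfOn_restart_Ioo hν.le (a := τ₀ - δ / 2) (b := τ₀)
    (by linarith) (by linarith) hτ₀.2.le
  have hσT : σ ∈ Ioo 0 T := ⟨by linarith [hσ.1], hσ.2.trans hτ₀.2⟩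
  have hAσ : eWeakGradL2Sq (u σ) ≤ ENNReal.ofReal A := by
    rw [hA, ENNReal.ofReal_toReal hM.ne]
    exact (le_add_self).trans ((eH1NormSq_def (u σ)).symm.le.trans (hMK σ ⟨by linarith [hσ.1], hσ.2.le⟩))
  set d : ℝ := min δ (T - σ) with hd
  have hdpos : 0 < d := lt_min hδpos (sub_pos.2 hσT.2)
  have hAd : A ^ 2 * d ≤ c₀ * ν ^ 3 := (mul_le_mul_of_nonneg_left (min_le_left _ _) (sq_nonneg A)).trans hAδ
  have hτ₀d : τ₀ - σ < d := lt_min (by linarith [hσ.1]) (by linarith [hτ₀.2])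
  have hu2 : MemLp (u σ) 2 volume := hLH.memLp σ ⟨hσT.1.le, hσT.2.le⟩
  have hdiv : IsWeaklyDivFree (u σ) := hLHσ.isWeaklyDivFree_datum (sub_pos.2 hσT.2)
  obtain ⟨v, q, hv, -, hvreg, hns, hclv⟩ := hreg hν hdpos hu2 hdiv ENNReal.toReal_nonneg hAσ hAd
  have hLHσ' : IsLerayHopfOn d ν 0 (u σ) (fun t => u (t + σ)) :=
    hLHσ.of_le (by linarith [min_le_right δ (T - σ)])
  have hS : MemLqLp ∞ 6 v (Ioo 0 d) :=
    memLqLp_top_six_of_isH1RegularOn_Icc hvreg fun t ht => hv.memLp t ht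
  have hqr : 2 / (∞ : ℝ≥0∞) + 3 / 6 ≤ 1 := by
    rw [ENNReal.div_top, zero_add]
    exact ENNReal.div_le_of_le_mul (by norm_num)
  have hae : ∀ t ∈ Ioc 0 d, u (t + σ) =ᵐ[volume] v t := fun t ht =>
    serrin_weak_strong_uniqueness_holds hν hdpos hv hu2 (q := ∞) (r := 6) (by norm_num) hqr hS hLHσ' t ht
  have heq : ∀ τ ∈ Ioo σ (σ + d), τ < T → u τ = v (τ - σ) := by
    intro τ hτ hτT
    have h1 : u τ =ᵐ[volume] v (τ - σ) := by
      have h := hae (τ - σ) ⟨sub_pos.2 hτ.1, by linarith [hτ.2]⟩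
      rwa [sub_add_cancel] at h
    have hcu : Continuous (u τ) := (hmax.1.contDiff_velocity ⟨hσT.1.le.trans hτ.1.le, hτT⟩).continuous
    have hcv : Continuous (v (τ - σ)) :=
      (hns.contDiff_velocity ⟨sub_pos.2 hτ.1, by linarith [hτ.2]⟩).continuous
    exact (Continuous.ae_eq_iff_eq volume hcu hcv).1 h1
  -- a regular slab `[a', b']` around `τ₀ - σ`
  set a' : ℝ := (τ₀ - σ) / 2 with ha'
  set b' : ℝ := (τ₀ - σ + d) / 2 with hb'
  have ha'pos : 0 < a' := by rw [ha']; linarith [hσ.2]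
  have hab' : a' < b' := by rw [ha', hb']; linarith
  have hb'd : b' ≤ d := by rw [hb']; linarith
  have ha'τ : a' < τ₀ - σ := by rw [ha']; linarith [hσ.2]
  have hτb' : τ₀ - σ < b' := by rw [hb']; linarith
  obtain ⟨hSob, hSobdt, hsup, hp⟩ := hclv a' ha'pos (hab'.le.trans hb'd)
  have hslab : IsSmoothSlabSolution a' b' ν v q :=
    isSmoothSlabSolution_of_regular hns ha'pos hab' hb'd hSob hSobdt hsup hp
  -- the block energy of `v` on the slab is a primitive, hence continuous
  set ψ : ℝ → ℝ := fun τ => ∫ x, ⟪blockFn j (v τ) x, blockFn j (timeDerivWithin (Icc a' b') v τ) x⟫ with hψ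
  set Ev : ℝ → ℝ := fun τ => ∫ x, ‖blockFn j (v τ) x‖ ^ 2 with hEv
  have hψint : IntervalIntegrable ψ volume a' b' :=
    hslab.regular.intervalIntegrable_inner_blockFn j le_rfl hab'.le le_rfl
  have hprim : ∀ τ ∈ Icc a' b', Ev τ = Ev a' + 2 * ∫ τ' in a'..τ, ψ τ' := by
    intro τ hτ
    have h := hslab.regular.integral_norm_blockFn_sq_sub_eq j le_rfl hτ.1 hτ.2
    simp only [hEv]
    linarith [h]
  have hcontEv : ContinuousOn Ev (Icc a' b') := by
    have hc : ContinuousOn (fun τ => Ev a' + 2 * ∫ τ' in a'..τ, ψ τ') (Icc a' b') := by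
      have h1 := intervalIntegral.continuousOn_primitive_interval' hψint (left_mem_uIcc)
      rw [uIcc_of_le hab'.le] at h1
      exact continuousOn_const.add (continuousOn_const.mul h1)
    exact hc.congr fun τ hτ => hprim τ hτ
  have hcontAt : ContinuousAt Ev (τ₀ - σ) :=
    hcontEv.continuousAt (Icc_mem_nhds ha'τ hτb')
  -- `blockL2 (u τ) j ^ 2 = ofReal (Ev (τ - σ))` near `τ₀`
  have hnhds : ∀ᶠ τ in 𝓝 τ₀, blockL2 (u τ) j ^ 2 = ENNReal.ofReal (Ev (τ - σ)) := by
    have hmem : Ioo (σ + a') (min (σ + b') T) ∈ 𝓝 τ₀ :=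
      Ioo_mem_nhds (by linarith) (lt_min (by linarith) hτ₀.2)
    filter_upwards [hmem] with τ hτ
    have hτT : τ < T := hτ.2.trans_le (min_le_right _ _)
    have hτb : τ < σ + b' := hτ.2.trans_le (min_le_left _ _)
    have hτI : τ - σ ∈ Icc a' b' := ⟨by linarith [hτ.1], by linarith⟩
    have hw : IsSmoothL2Field (v (τ - σ)) := hslab.smooth_slice _ hτI
    rw [heq τ ⟨by linarith [hτ.1], by linarith [hb'd]⟩ hτT, hEv]
    simp only
    rw [integral_norm_sq_eq_toReal_eLpNorm_sq ((hw.blockFn j).memLp_two).1,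
      ENNReal.ofReal_toReal (ENNReal.pow_ne_top ((hw.blockFn j).memLp_two).eLpNorm_ne_top)]
    rfl
  refine (ContinuousAt.congr ?_ (EventuallyEq.symm hnhds))
  exact ENNReal.continuous_ofReal.continuousAt.comp (hcontAt.comp_of_eq (continuousAt_id.sub continuousAt_const) rfl)

/-- **Continuity on the open lifespan**: `τ ↦ ‖Δ̇_j u(τ)‖₂²` is continuous on `(0, T)` for every level `j`.
[cite: CheskidovShvydkoy2010, Lemma 3.2 (proof, (8))] -/
theorem continuousOn_blockL2_sq {ν T : ℝ} (hν : 0 < ν) (hT : 0 < T)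
    {u : ℝ → EuclideanSpace ℝ (Fin 3) → EuclideanSpace ℝ (Fin 3)} {p : ℝ → EuclideanSpace ℝ (Fin 3) → ℝ}
    (hmax : IsMaximalSmoothSolution ν 0 u p T) (hLH : IsLerayHopfOn T ν 0 (u 0) u) (j : ℤ) :
    ContinuousOn (fun τ => blockL2 (u τ) j ^ 2) (Ioo 0 T) := fun _ hτ =>
  (continuousAt_blockL2_sq hν hT hmax hLH j hτ).continuousWithinAt

/-- **Measurability in time** of the block energies on every window `(s, t] ⊂ (0, T)`. [folklore] -/
theorem aemeasurable_blockL2_sq_Ioc {ν T : ℝ} (hν : 0 < ν) (hT : 0 < T)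
    {u : ℝ → EuclideanSpace ℝ (Fin 3) → EuclideanSpace ℝ (Fin 3)} {p : ℝ → EuclideanSpace ℝ (Fin 3) → ℝ}
    (hmax : IsMaximalSmoothSolution ν 0 u p T) (hLH : IsLerayHopfOn T ν 0 (u 0) u) (j : ℤ)
    {s t : ℝ} (hs : 0 < s) (htT : t < T) :
    AEMeasurable (fun τ => blockL2 (u τ) j ^ 2) (volume.restrict (Ioc s t)) :=
  (((continuousOn_blockL2_sq hν hT hmax hLH j).mono fun _ hτ => ⟨hs.trans hτ.1, hτ.2.trans_lt htT⟩).aemeasurable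
    measurableSet_Ioc)

/-! ## The viscous rent, Markov form -/

/-- **The VISCOUS RENT of holding a level (Markov form).** For every maximal smooth solution `(u, p)` of the unforced
Navier–Stokes system on `ℝ³ × [0, T)` (`ν > 0`) which is Leray–Hopf from `u 0`, all `0 < s ≤ t < T`, every level `j ∈ ℤ`
and every threshold `E ∈ [0, ∞]`: with `ρ = |{τ ∈ (s, t] : ‖Δ̇_j u(τ)‖₂² ≥ E}|` (Lebesgue measure of the dwell set),
`2ν · 4^j · (E · ρ) ≤ 3 C_r² ‖Δ̇_j u(s)‖₂² + 3 C_r² · 2 ∫⁻_{(s,t]} (−N_j(u(τ)))⁺ dτ`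
(`C_r` the reverse-Bernstein constant of `BlockViscousRent.feeding_ge_rent`): the time a level dwells at energy at
least `E` is priced at the viscous rate `ν k_j²` of the level, the bill being met by the initial stock and the
nonlinear feeding. Proof: `BlockViscousRent.feeding_ge_rent` (gain dropped) and Markov's inequality on the dissipation
integral, legitimate because the block energy is continuous in time (`continuousOn_blockL2_sq`).
[cite: CheskidovShvydkoy2010, Lemma 3.2 (proof, (8))] -/
theorem feeding_ge_level_rent {ν T : ℝ} (hν : 0 < ν) (hT : 0 < T)
    {u : ℝ → EuclideanSpace ℝ (Fin 3) → EuclideanSpace ℝ (Fin 3)} {p : ℝ → EuclideanSpace ℝ (Fin 3) → ℝ}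
    (hmax : IsMaximalSmoothSolution ν 0 u p T) (hLH : IsLerayHopfOn T ν 0 (u 0) u)
    {s t : ℝ} (hs : 0 < s) (hst : s ≤ t) (htT : t < T) (j : ℤ) (E : ℝ≥0∞) :
    2 * ENNReal.ofReal ν * (2 : ℝ≥0∞) ^ (2 * j) *
        (E * volume ({τ | E ≤ blockL2 (u τ) j ^ 2} ∩ Ioc s t)) ≤
      3 * ((lpBounds (Fin 3)).Cr : ℝ≥0∞) ^ 2 * blockL2 (u s) j ^ 2 +
        3 * ((lpBounds (Fin 3)).Cr : ℝ≥0∞) ^ 2 * (2 * ∫⁻ τ in Ioc s t, ENNReal.ofReal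
          (-(∫ x, ⟪blockFn j (u τ) x, blockFn j (convect (u τ) (u τ)) x⟫))) := by
  have h := BlockViscousRent.feeding_ge_rent hν hT hmax hLH hs hst htT j
  have hmarkov : E * volume ({τ | E ≤ blockL2 (u τ) j ^ 2} ∩ Ioc s t) ≤ ∫⁻ τ in Ioc s t, blockL2 (u τ) j ^ 2 := by
    rw [← Measure.restrict_apply' measurableSet_Ioc]
    exact mul_meas_ge_le_lintegral₀ (aemeasurable_blockL2_sq_Ioc hν hT hmax hLH j hs htT) E
  calc 2 * ENNReal.ofReal ν * (2 : ℝ≥0∞) ^ (2 * j) * (E * volume ({τ | E ≤ blockL2 (u τ) j ^ 2} ∩ Ioc s t))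
      ≤ 2 * ENNReal.ofReal ν * (2 : ℝ≥0∞) ^ (2 * j) * ∫⁻ τ in Ioc s t, blockL2 (u τ) j ^ 2 := by gcongr
    _ ≤ 3 * ((lpBounds (Fin 3)).Cr : ℝ≥0∞) ^ 2 * blockL2 (u t) j ^ 2 +
          2 * ENNReal.ofReal ν * (2 : ℝ≥0∞) ^ (2 * j) * ∫⁻ τ in Ioc s t, blockL2 (u τ) j ^ 2 := le_add_self
    _ ≤ _ := h

end Summit.NavierStokesRegularity.FluidComputer.BlockEnergyContinuity

end
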